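import Summits.CriticalPhenomena.PercolationContinuityZ3.Theorems.PercNearOneGluingAdditiveGluingDKernelReduction2
import Summits.CriticalPhenomena.PercolationContinuityZ3.Theorems.PercNearOneGluingAdditiveGluingDKernelThree
import Summits.CriticalPhenomena.PercolationContinuityZ3.Theorems.PercNearOneGluingAdditiveGluingDKernelEdge
import HarnessLib

/-! # Crux `PercNearOneGluing.AdditiveGluing` (stmt-CriticalPhenomena-4576) — third D-kernel reduction: the residual class of
# {isolated · `A.card ≤ 3` · leaf · KN Theorem 2 at the designation · BLOCK-EDGE DELETION switch · interpolation} (seat (d) round 4)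

Support file (`--supports stmt-CriticalPhenomena-4576`); no definitions, no named facts.  CONDITIONAL result (hypothesis spelled out).

`cone_dkernel_of_cert2` plus the D-version of the single-edge switch (`dKernel_of_edgeMin`, file `…DKernelEdge`): for a block edge
`e = s(x,y)` (`x ∈ S ∌ y`, `u e ≠ 0`) and a minimiser `d` of `μ_{u[e↦0]}(· ↔ b)` over `A`, `d` is `D`-good for `(u,S)` (layers `S` and
`insert y S` in `u[e↦0]` by the induction hypothesis / Lemma 5), hence `a₀` is `D`-good as soon as `κ_{u/S}(a₀) ≤ κ_{u/S}(d)`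
(`dKernel_mono_designated`).  Census of this seat: the block-edge deletion family is the strongest single generator family (gen-0 GDM records:
22/22; robust positive margins where the pure interpolation certificate is only marginal).  `additiveGluing_of_dcert3 : DCERT3 → AdditiveGluing`.
[cite: KozmaNitzan2024, §3.2 pp. 8–9, 12–14, Lemma 5 p. 13, §5.3 p. 34]
-/

namespace Summit.CriticalPhenomena.PercolationContinuityZ3.Theorems

open MeasureTheory Set
open Literature.Probability.LatticeModels (prodBernoulli)
open Literature.Probability.Percolation (BondConfig openConn openConnIn openGraph openCluster)
open scoped BigOperators

noncomputable section
open Classical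

section DKernelReduction3

open Literature.Probability.LatticeModels Literature.Probability.Percolation

variable {n : ℕ}

/-- **The designated-pocket kernel for every block, from a certificate on the residual class of the D-calculus with the block-edge
deletion switch** (strong induction on `#positive pairs + #fractional pairs`).  [cite: KozmaNitzan2024, §3.2 pp. 8–9 and 12–14, §5.3 p. 34] -/
theorem cone_dkernel_of_cert3
    (hG : ∀ (n : ℕ) (u : Sym2 (Fin n) → unitInterval) (A S : Finset (Fin n)) (b a₀ : Fin n),
      b ∈ A → Disjoint S A → a₀ ∈ A →
      (∀ a ∈ A, (prodBernoulli u).real (openConn a₀ b) ≤ (prodBernoulli u).real (openConn a b)) →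
      4 ≤ A.card →
      (∃ x ∈ S, ∃ y : Fin n, (u s(x, y) : ℝ) ≠ 0) →
      (∀ v ∈ S, (prodBernoulli u).real (openConn v b) < (prodBernoulli u).real (openConn a₀ b)) →
      -- no block-edge deletion switch
      ¬ (∃ x ∈ S, ∃ y : Fin n, y ∉ S ∧ (u s(x, y) : ℝ) ≠ 0 ∧ ∃ d ∈ A,
          (∀ a ∈ A, (prodBernoulli (Function.update u s(x, y) 0)).real (openConn d b) ≤ (prodBernoulli (Function.update u s(x, y) 0)).real (openConn a b)) ∧
          (prodBernoulli (fun e' : Sym2 (Fin n) => if (∀ y ∈ e', y ∈ S) ∧ ¬ e'.IsDiag then 1 else u e')).real ((⋃ v ∈ S, ⋃ a ∈ A, openConn v a) ∩ openConn a₀ b)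
            ≤ (prodBernoulli (fun e' : Sym2 (Fin n) => if (∀ y ∈ e', y ∈ S) ∧ ¬ e'.IsDiag then 1 else u e')).real ((⋃ v ∈ S, ⋃ a ∈ A, openConn v a) ∩ openConn d b)) →
      -- no KN-Theorem-2 certificate (three relays)
      ¬ (∃ s₀ ∈ S, ∃ a₁ a₂ : Fin n, (∀ a ∈ A, a = b ∨ a = a₁ ∨ a = a₂ ∨ a = a₀) ∧ a₁ ≠ a₂ ∧ a₁ ≠ a₀ ∧ a₂ ≠ a₀ ∧
          0 < (prodBernoulli (fun e' : Sym2 (Fin n) => if (∀ y ∈ e', y ∈ S) ∧ ¬ e'.IsDiag then 1 else u e')).real ((openConn a₁ a₀)ᶜ ∩ (openConn a₂ a₀)ᶜ : Set (BondConfig (Fin n))) ∧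
          0 < (prodBernoulli (fun e' : Sym2 (Fin n) => if (∀ y ∈ e', y ∈ S) ∧ ¬ e'.IsDiag then 1 else u e')).real ((openConn a₁ a₂)ᶜ ∩ (openConn a₁ a₀)ᶜ : Set (BondConfig (Fin n))) ∧
          0 < (prodBernoulli (fun e' : Sym2 (Fin n) => if (∀ y ∈ e', y ∈ S) ∧ ¬ e'.IsDiag then 1 else u e')).real ((openConn a₂ a₁)ᶜ ∩ (openConn a₂ a₀)ᶜ : Set (BondConfig (Fin n))) ∧
          0 ≤ (prodBernoulli (fun e' : Sym2 (Fin n) => if (∀ y ∈ e', y ∈ S) ∧ ¬ e'.IsDiag then 1 else u e')).real ((openConn a₁ a₂)ᶜ ∩ (openConn a₁ a₀)ᶜ ∩ openConn a₁ s₀)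
                * (prodBernoulli (fun e' : Sym2 (Fin n) => if (∀ y ∈ e', y ∈ S) ∧ ¬ e'.IsDiag then 1 else u e')).real ((openConn a₂ a₁)ᶜ ∩ (openConn a₂ a₀)ᶜ : Set (BondConfig (Fin n)))
                * ((prodBernoulli (fun e' : Sym2 (Fin n) => if (∀ y ∈ e', y ∈ S) ∧ ¬ e'.IsDiag then 1 else u e')).real (openConn a₁ b) - (prodBernoulli (fun e' : Sym2 (Fin n) => if (∀ y ∈ e', y ∈ S) ∧ ¬ e'.IsDiag then 1 else u e')).real (openConn a₀ b))
              + (prodBernoulli (fun e' : Sym2 (Fin n) => if (∀ y ∈ e', y ∈ S) ∧ ¬ e'.IsDiag then 1 else u e')).real ((openConn a₂ a₁)ᶜ ∩ (openConn a₂ a₀)ᶜ ∩ openConn a₂ s₀)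
                * (prodBernoulli (fun e' : Sym2 (Fin n) => if (∀ y ∈ e', y ∈ S) ∧ ¬ e'.IsDiag then 1 else u e')).real ((openConn a₁ a₂)ᶜ ∩ (openConn a₁ a₀)ᶜ : Set (BondConfig (Fin n)))
                * ((prodBernoulli (fun e' : Sym2 (Fin n) => if (∀ y ∈ e', y ∈ S) ∧ ¬ e'.IsDiag then 1 else u e')).real (openConn a₂ b) - (prodBernoulli (fun e' : Sym2 (Fin n) => if (∀ y ∈ e', y ∈ S) ∧ ¬ e'.IsDiag then 1 else u e')).real (openConn a₀ b)) ∧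
          (prodBernoulli (fun e' : Sym2 (Fin n) => if (∀ y ∈ e', y ∈ S) ∧ ¬ e'.IsDiag then 1 else u e')).real (openConn b a₀ ∩ (openConn b a₁)ᶜ ∩ (openConn b a₂)ᶜ)
            ≤ (prodBernoulli (fun e' : Sym2 (Fin n) => if (∀ y ∈ e', y ∈ S) ∧ ¬ e'.IsDiag then 1 else u e')).real (openConn b a₁ ∩ openConn b a₂ ∩ (openConn b a₀)ᶜ)) →
      -- no interpolation switch with endpoint certificates (minimiser or leaf)
      ¬ (∃ e : Sym2 (Fin n), 0 < (u e : ℝ) ∧ (u e : ℝ) < 1 ∧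
          ((∃ d ∈ A, (∀ a ∈ A, (prodBernoulli (Function.update u e 0)).real (openConn d b) ≤ (prodBernoulli (Function.update u e 0)).real (openConn a b)) ∧
              (prodBernoulli (fun e' : Sym2 (Fin n) => if (∀ y ∈ e', y ∈ S) ∧ ¬ e'.IsDiag then 1 else Function.update u e 0 e')).real ((⋃ v ∈ S, ⋃ a ∈ A, openConn v a) ∩ openConn a₀ b)
                ≤ (prodBernoulli (fun e' : Sym2 (Fin n) => if (∀ y ∈ e', y ∈ S) ∧ ¬ e'.IsDiag then 1 else Function.update u e 0 e')).real ((⋃ v ∈ S, ⋃ a ∈ A, openConn v a) ∩ openConn d b))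
          ∨ (∃ v ∈ S, (prodBernoulli (Function.update u e 0)).real (openConn a₀ b) ≤ (prodBernoulli (Function.update u e 0)).real (openConn v b))) ∧
          ((∃ d ∈ A, (∀ a ∈ A, (prodBernoulli (Function.update u e 1)).real (openConn d b) ≤ (prodBernoulli (Function.update u e 1)).real (openConn a b)) ∧
              (prodBernoulli (fun e' : Sym2 (Fin n) => if (∀ y ∈ e', y ∈ S) ∧ ¬ e'.IsDiag then 1 else Function.update u e 1 e')).real ((⋃ v ∈ S, ⋃ a ∈ A, openConn v a) ∩ openConn a₀ b)
                ≤ (prodBernoulli (fun e' : Sym2 (Fin n) => if (∀ y ∈ e', y ∈ S) ∧ ¬ e'.IsDiag then 1 else Function.update u e 1 e')).real ((⋃ v ∈ S, ⋃ a ∈ A, openConn v a) ∩ openConn d b))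
          ∨ (∃ v ∈ S, (prodBernoulli (Function.update u e 1)).real (openConn a₀ b) ≤ (prodBernoulli (Function.update u e 1)).real (openConn v b)))) →
      (prodBernoulli (fun e' : Sym2 (Fin n) => if (∀ y ∈ e', y ∈ S) ∧ ¬ e'.IsDiag then 1 else u e')).real ((⋃ v ∈ S, ⋃ a ∈ A, openConn v a) ∩ openConn a₀ b)
        ≤ (prodBernoulli (fun e' : Sym2 (Fin n) => if (∀ y ∈ e', y ∈ S) ∧ ¬ e'.IsDiag then 1 else u e')).real (⋃ v ∈ S, openConn v b)) :
    ∀ (n : ℕ) (u : Sym2 (Fin n) → unitInterval) (A S : Finset (Fin n)) (b a₀ : Fin n),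
      b ∈ A → Disjoint S A → a₀ ∈ A →
      (∀ a ∈ A, (prodBernoulli u).real (openConn a₀ b) ≤ (prodBernoulli u).real (openConn a b)) →
      (prodBernoulli (fun e' : Sym2 (Fin n) => if (∀ y ∈ e', y ∈ S) ∧ ¬ e'.IsDiag then 1 else u e')).real ((⋃ v ∈ S, ⋃ a ∈ A, openConn v a) ∩ openConn a₀ b)
        ≤ (prodBernoulli (fun e' : Sym2 (Fin n) => if (∀ y ∈ e', y ∈ S) ∧ ¬ e'.IsDiag then 1 else u e')).real (⋃ v ∈ S, openConn v b) := by
  intro n u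
  suffices H : ∀ (m : ℕ) (u : Sym2 (Fin n) → unitInterval),
      (Finset.univ.filter (fun e' : Sym2 (Fin n) => 0 < (u e' : ℝ))).card
        + (Finset.univ.filter (fun e' : Sym2 (Fin n) => 0 < (u e' : ℝ) ∧ (u e' : ℝ) < 1)).card = m →
      ∀ (A S : Finset (Fin n)) (b a₀ : Fin n),
      b ∈ A → Disjoint S A → a₀ ∈ A →
      (∀ a ∈ A, (prodBernoulli u).real (openConn a₀ b) ≤ (prodBernoulli u).real (openConn a b)) →
      (prodBernoulli (fun e' : Sym2 (Fin n) => if (∀ y ∈ e', y ∈ S) ∧ ¬ e'.IsDiag then 1 else u e')).real ((⋃ v ∈ S, ⋃ a ∈ A, openConn v a) ∩ openConn a₀ b)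
        ≤ (prodBernoulli (fun e' : Sym2 (Fin n) => if (∀ y ∈ e', y ∈ S) ∧ ¬ e'.IsDiag then 1 else u e')).real (⋃ v ∈ S, openConn v b) from
    fun A S b a₀ => H _ u rfl A S b a₀
  intro m
  induction m using Nat.strong_induction_on with
  | _ m ih =>
  intro u hm A S b a₀ hb hSA ha₀ hmin
  have hbS : b ∉ S := fun h => Finset.disjoint_left.1 hSA h hb
  by_cases hSne : S.Nonempty
  swap
  · rw [Finset.not_nonempty_iff_eq_empty.1 hSne]
    simp
  by_cases hiso : ∀ v ∈ S, ∀ y : Fin n, (u s(y, v) : ℝ) = 0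
  · exact dKernel_of_blockGood u A S b a₀ hb hSne ha₀ (stub_isolatedBlock_c5 n u A S b a₀ hb hSA ha₀ hmin hiso)
  have hex : ∃ x ∈ S, ∃ y : Fin n, (u s(x, y) : ℝ) ≠ 0 := by
    push Not at hiso
    obtain ⟨v, hv, y, hy⟩ := hiso
    refine ⟨v, hv, y, ?_⟩
    rw [Sym2.eq_swap]
    exact hy
  by_cases hA3 : A.card ≤ 3
  · exact dKernel_of_blockGood u A S b a₀ hb hSne ha₀ (blockGood_cardLeThree_inf u A S b a₀ hb ha₀ hA3 hSne hmin)
  have hA4 : 4 ≤ A.card := by omega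
  by_cases hleaf : ∃ v ∈ S, (prodBernoulli u).real (openConn a₀ b) ≤ (prodBernoulli u).real (openConn v b)
  · obtain ⟨v, hv, hle⟩ := hleaf
    exact dKernel_of_leaf u A S b a₀ v hv hbS hle
  -- block-edge deletion switch (inner induction hypothesis at `u[e↦0]`)
  by_cases hed : (∃ x ∈ S, ∃ y : Fin n, y ∉ S ∧ (u s(x, y) : ℝ) ≠ 0 ∧ ∃ d ∈ A,
          (∀ a ∈ A, (prodBernoulli (Function.update u s(x, y) 0)).real (openConn d b) ≤ (prodBernoulli (Function.update u s(x, y) 0)).real (openConn a b)) ∧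
          (prodBernoulli (fun e' : Sym2 (Fin n) => if (∀ y ∈ e', y ∈ S) ∧ ¬ e'.IsDiag then 1 else u e')).real ((⋃ v ∈ S, ⋃ a ∈ A, openConn v a) ∩ openConn a₀ b)
            ≤ (prodBernoulli (fun e' : Sym2 (Fin n) => if (∀ y ∈ e', y ∈ S) ∧ ¬ e'.IsDiag then 1 else u e')).real ((⋃ v ∈ S, ⋃ a ∈ A, openConn v a) ∩ openConn d b))
  · obtain ⟨x, hx, y, hyS, hne, d, hd, hdmin, hle⟩ := hed
    have hlt := interpSw_measure_update_zero_lt u s(x, y) hne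
    rw [hm] at hlt
    exact le_trans hle (dKernel_of_edgeMin u A S b d x y hb hSA hx hyS hdmin
      (fun S' hS'A => ih _ hlt (Function.update u s(x, y) 0) rfl A S' b d hb hS'A hd hdmin))
  -- KN Theorem 2 at the designation (three relays)
  by_cases hkn : (∃ s₀ ∈ S, ∃ a₁ a₂ : Fin n, (∀ a ∈ A, a = b ∨ a = a₁ ∨ a = a₂ ∨ a = a₀) ∧ a₁ ≠ a₂ ∧ a₁ ≠ a₀ ∧ a₂ ≠ a₀ ∧
          0 < (prodBernoulli (fun e' : Sym2 (Fin n) => if (∀ y ∈ e', y ∈ S) ∧ ¬ e'.IsDiag then 1 else u e')).real ((openConn a₁ a₀)ᶜ ∩ (openConn a₂ a₀)ᶜ : Set (BondConfig (Fin n))) ∧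
          0 < (prodBernoulli (fun e' : Sym2 (Fin n) => if (∀ y ∈ e', y ∈ S) ∧ ¬ e'.IsDiag then 1 else u e')).real ((openConn a₁ a₂)ᶜ ∩ (openConn a₁ a₀)ᶜ : Set (BondConfig (Fin n))) ∧
          0 < (prodBernoulli (fun e' : Sym2 (Fin n) => if (∀ y ∈ e', y ∈ S) ∧ ¬ e'.IsDiag then 1 else u e')).real ((openConn a₂ a₁)ᶜ ∩ (openConn a₂ a₀)ᶜ : Set (BondConfig (Fin n))) ∧
          0 ≤ (prodBernoulli (fun e' : Sym2 (Fin n) => if (∀ y ∈ e', y ∈ S) ∧ ¬ e'.IsDiag then 1 else u e')).real ((openConn a₁ a₂)ᶜ ∩ (openConn a₁ a₀)ᶜ ∩ openConn a₁ s₀)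
                * (prodBernoulli (fun e' : Sym2 (Fin n) => if (∀ y ∈ e', y ∈ S) ∧ ¬ e'.IsDiag then 1 else u e')).real ((openConn a₂ a₁)ᶜ ∩ (openConn a₂ a₀)ᶜ : Set (BondConfig (Fin n)))
                * ((prodBernoulli (fun e' : Sym2 (Fin n) => if (∀ y ∈ e', y ∈ S) ∧ ¬ e'.IsDiag then 1 else u e')).real (openConn a₁ b) - (prodBernoulli (fun e' : Sym2 (Fin n) => if (∀ y ∈ e', y ∈ S) ∧ ¬ e'.IsDiag then 1 else u e')).real (openConn a₀ b))
              + (prodBernoulli (fun e' : Sym2 (Fin n) => if (∀ y ∈ e', y ∈ S) ∧ ¬ e'.IsDiag then 1 else u e')).real ((openConn a₂ a₁)ᶜ ∩ (openConn a₂ a₀)ᶜ ∩ openConn a₂ s₀)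
                * (prodBernoulli (fun e' : Sym2 (Fin n) => if (∀ y ∈ e', y ∈ S) ∧ ¬ e'.IsDiag then 1 else u e')).real ((openConn a₁ a₂)ᶜ ∩ (openConn a₁ a₀)ᶜ : Set (BondConfig (Fin n)))
                * ((prodBernoulli (fun e' : Sym2 (Fin n) => if (∀ y ∈ e', y ∈ S) ∧ ¬ e'.IsDiag then 1 else u e')).real (openConn a₂ b) - (prodBernoulli (fun e' : Sym2 (Fin n) => if (∀ y ∈ e', y ∈ S) ∧ ¬ e'.IsDiag then 1 else u e')).real (openConn a₀ b)) ∧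
          (prodBernoulli (fun e' : Sym2 (Fin n) => if (∀ y ∈ e', y ∈ S) ∧ ¬ e'.IsDiag then 1 else u e')).real (openConn b a₀ ∩ (openConn b a₁)ᶜ ∩ (openConn b a₂)ᶜ)
            ≤ (prodBernoulli (fun e' : Sym2 (Fin n) => if (∀ y ∈ e', y ∈ S) ∧ ¬ e'.IsDiag then 1 else u e')).real (openConn b a₁ ∩ openConn b a₂ ∩ (openConn b a₀)ᶜ))
  · obtain ⟨s₀, hs₀, a₁, a₂, hAsub, h12, h10, h20, hP₁₂, hP₁, hP₂, hcert, hgood⟩ := hkn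
    exact dKernel_union_three_of_knThm2 u A S s₀ b a₁ a₂ a₀ hs₀ hAsub h12 h10 h20 hP₁₂ hP₁ hP₂ hcert hgood
  -- interpolation with endpoint certificates
  by_cases his : (∃ e : Sym2 (Fin n), 0 < (u e : ℝ) ∧ (u e : ℝ) < 1 ∧
          ((∃ d ∈ A, (∀ a ∈ A, (prodBernoulli (Function.update u e 0)).real (openConn d b) ≤ (prodBernoulli (Function.update u e 0)).real (openConn a b)) ∧
              (prodBernoulli (fun e' : Sym2 (Fin n) => if (∀ y ∈ e', y ∈ S) ∧ ¬ e'.IsDiag then 1 else Function.update u e 0 e')).real ((⋃ v ∈ S, ⋃ a ∈ A, openConn v a) ∩ openConn a₀ b)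
                ≤ (prodBernoulli (fun e' : Sym2 (Fin n) => if (∀ y ∈ e', y ∈ S) ∧ ¬ e'.IsDiag then 1 else Function.update u e 0 e')).real ((⋃ v ∈ S, ⋃ a ∈ A, openConn v a) ∩ openConn d b))
          ∨ (∃ v ∈ S, (prodBernoulli (Function.update u e 0)).real (openConn a₀ b) ≤ (prodBernoulli (Function.update u e 0)).real (openConn v b))) ∧
          ((∃ d ∈ A, (∀ a ∈ A, (prodBernoulli (Function.update u e 1)).real (openConn d b) ≤ (prodBernoulli (Function.update u e 1)).real (openConn a b)) ∧
              (prodBernoulli (fun e' : Sym2 (Fin n) => if (∀ y ∈ e', y ∈ S) ∧ ¬ e'.IsDiag then 1 else Function.update u e 1 e')).real ((⋃ v ∈ S, ⋃ a ∈ A, openConn v a) ∩ openConn a₀ b)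
                ≤ (prodBernoulli (fun e' : Sym2 (Fin n) => if (∀ y ∈ e', y ∈ S) ∧ ¬ e'.IsDiag then 1 else Function.update u e 1 e')).real ((⋃ v ∈ S, ⋃ a ∈ A, openConn v a) ∩ openConn d b))
          ∨ (∃ v ∈ S, (prodBernoulli (Function.update u e 1)).real (openConn a₀ b) ≤ (prodBernoulli (Function.update u e 1)).real (openConn v b))))
  · obtain ⟨e, he0, he1, hc0, hc1⟩ := his
    have hlt0 := interpSw_measure_update_zero_lt u e (ne_of_gt he0)
    have hlt1 := interpSw_measure_update_one_lt u e he0 he1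
    rw [hm] at hlt0 hlt1
    refine dKernel_interp u A S b a₀ e ?_ ?_
    · rcases hc0 with ⟨d, hd, hdmin, hle⟩ | ⟨v, hv, hle⟩
      · exact le_trans hle (ih _ hlt0 (Function.update u e 0) rfl A S b d hb hSA hd hdmin)
      · exact dKernel_of_leaf (Function.update u e 0) A S b a₀ v hv hbS hle
    · rcases hc1 with ⟨d, hd, hdmin, hle⟩ | ⟨v, hv, hle⟩
      · exact le_trans hle (ih _ hlt1 (Function.update u e 1) rfl A S b d hb hSA hd hdmin)
      · exact dKernel_of_leaf (Function.update u e 1) A S b a₀ v hv hbS hle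
  -- the residual class: use the certificate
  have hbad : ∀ v ∈ S, (prodBernoulli u).real (openConn v b) < (prodBernoulli u).real (openConn a₀ b) := by
    intro v hv
    by_contra h
    exact hleaf ⟨v, hv, not_lt.1 h⟩
  exact hG n u A S b a₀ hb hSA ha₀ hmin hA4 hex hbad hed hkn his

/-- **`AdditiveGluing` from a certificate on the residual class of the D-calculus with the block-edge deletion switch** (crux statement unfolded).
[cite: KozmaNitzan2024, §3.2 pp. 8–9, 12–14, Question 9 p. 36] -/
theorem additiveGluing_of_dcert3
    (hG : ∀ (n : ℕ) (u : Sym2 (Fin n) → unitInterval) (A S : Finset (Fin n)) (b a₀ : Fin n),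
      b ∈ A → Disjoint S A → a₀ ∈ A →
      (∀ a ∈ A, (prodBernoulli u).real (openConn a₀ b) ≤ (prodBernoulli u).real (openConn a b)) →
      4 ≤ A.card →
      (∃ x ∈ S, ∃ y : Fin n, (u s(x, y) : ℝ) ≠ 0) →
      (∀ v ∈ S, (prodBernoulli u).real (openConn v b) < (prodBernoulli u).real (openConn a₀ b)) →
      -- no block-edge deletion switch
      ¬ (∃ x ∈ S, ∃ y : Fin n, y ∉ S ∧ (u s(x, y) : ℝ) ≠ 0 ∧ ∃ d ∈ A,
          (∀ a ∈ A, (prodBernoulli (Function.update u s(x, y) 0)).real (openConn d b) ≤ (prodBernoulli (Function.update u s(x, y) 0)).real (openConn a b)) ∧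
          (prodBernoulli (fun e' : Sym2 (Fin n) => if (∀ y ∈ e', y ∈ S) ∧ ¬ e'.IsDiag then 1 else u e')).real ((⋃ v ∈ S, ⋃ a ∈ A, openConn v a) ∩ openConn a₀ b)
            ≤ (prodBernoulli (fun e' : Sym2 (Fin n) => if (∀ y ∈ e', y ∈ S) ∧ ¬ e'.IsDiag then 1 else u e')).real ((⋃ v ∈ S, ⋃ a ∈ A, openConn v a) ∩ openConn d b)) →
      -- no KN-Theorem-2 certificate (three relays)
      ¬ (∃ s₀ ∈ S, ∃ a₁ a₂ : Fin n, (∀ a ∈ A, a = b ∨ a = a₁ ∨ a = a₂ ∨ a = a₀) ∧ a₁ ≠ a₂ ∧ a₁ ≠ a₀ ∧ a₂ ≠ a₀ ∧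
          0 < (prodBernoulli (fun e' : Sym2 (Fin n) => if (∀ y ∈ e', y ∈ S) ∧ ¬ e'.IsDiag then 1 else u e')).real ((openConn a₁ a₀)ᶜ ∩ (openConn a₂ a₀)ᶜ : Set (BondConfig (Fin n))) ∧
          0 < (prodBernoulli (fun e' : Sym2 (Fin n) => if (∀ y ∈ e', y ∈ S) ∧ ¬ e'.IsDiag then 1 else u e')).real ((openConn a₁ a₂)ᶜ ∩ (openConn a₁ a₀)ᶜ : Set (BondConfig (Fin n))) ∧
          0 < (prodBernoulli (fun e' : Sym2 (Fin n) => if (∀ y ∈ e', y ∈ S) ∧ ¬ e'.IsDiag then 1 else u e')).real ((openConn a₂ a₁)ᶜ ∩ (openConn a₂ a₀)ᶜ : Set (BondConfig (Fin n))) ∧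
          0 ≤ (prodBernoulli (fun e' : Sym2 (Fin n) => if (∀ y ∈ e', y ∈ S) ∧ ¬ e'.IsDiag then 1 else u e')).real ((openConn a₁ a₂)ᶜ ∩ (openConn a₁ a₀)ᶜ ∩ openConn a₁ s₀)
                * (prodBernoulli (fun e' : Sym2 (Fin n) => if (∀ y ∈ e', y ∈ S) ∧ ¬ e'.IsDiag then 1 else u e')).real ((openConn a₂ a₁)ᶜ ∩ (openConn a₂ a₀)ᶜ : Set (BondConfig (Fin n)))
                * ((prodBernoulli (fun e' : Sym2 (Fin n) => if (∀ y ∈ e', y ∈ S) ∧ ¬ e'.IsDiag then 1 else u e')).real (openConn a₁ b) - (prodBernoulli (fun e' : Sym2 (Fin n) => if (∀ y ∈ e', y ∈ S) ∧ ¬ e'.IsDiag then 1 else u e')).real (openConn a₀ b))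
              + (prodBernoulli (fun e' : Sym2 (Fin n) => if (∀ y ∈ e', y ∈ S) ∧ ¬ e'.IsDiag then 1 else u e')).real ((openConn a₂ a₁)ᶜ ∩ (openConn a₂ a₀)ᶜ ∩ openConn a₂ s₀)
                * (prodBernoulli (fun e' : Sym2 (Fin n) => if (∀ y ∈ e', y ∈ S) ∧ ¬ e'.IsDiag then 1 else u e')).real ((openConn a₁ a₂)ᶜ ∩ (openConn a₁ a₀)ᶜ : Set (BondConfig (Fin n)))
                * ((prodBernoulli (fun e' : Sym2 (Fin n) => if (∀ y ∈ e', y ∈ S) ∧ ¬ e'.IsDiag then 1 else u e')).real (openConn a₂ b) - (prodBernoulli (fun e' : Sym2 (Fin n) => if (∀ y ∈ e', y ∈ S) ∧ ¬ e'.IsDiag then 1 else u e')).real (openConn a₀ b)) ∧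
          (prodBernoulli (fun e' : Sym2 (Fin n) => if (∀ y ∈ e', y ∈ S) ∧ ¬ e'.IsDiag then 1 else u e')).real (openConn b a₀ ∩ (openConn b a₁)ᶜ ∩ (openConn b a₂)ᶜ)
            ≤ (prodBernoulli (fun e' : Sym2 (Fin n) => if (∀ y ∈ e', y ∈ S) ∧ ¬ e'.IsDiag then 1 else u e')).real (openConn b a₁ ∩ openConn b a₂ ∩ (openConn b a₀)ᶜ)) →
      -- no interpolation switch with endpoint certificates (minimiser or leaf)
      ¬ (∃ e : Sym2 (Fin n), 0 < (u e : ℝ) ∧ (u e : ℝ) < 1 ∧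
          ((∃ d ∈ A, (∀ a ∈ A, (prodBernoulli (Function.update u e 0)).real (openConn d b) ≤ (prodBernoulli (Function.update u e 0)).real (openConn a b)) ∧
              (prodBernoulli (fun e' : Sym2 (Fin n) => if (∀ y ∈ e', y ∈ S) ∧ ¬ e'.IsDiag then 1 else Function.update u e 0 e')).real ((⋃ v ∈ S, ⋃ a ∈ A, openConn v a) ∩ openConn a₀ b)
                ≤ (prodBernoulli (fun e' : Sym2 (Fin n) => if (∀ y ∈ e', y ∈ S) ∧ ¬ e'.IsDiag then 1 else Function.update u e 0 e')).real ((⋃ v ∈ S, ⋃ a ∈ A, openConn v a) ∩ openConn d b))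
          ∨ (∃ v ∈ S, (prodBernoulli (Function.update u e 0)).real (openConn a₀ b) ≤ (prodBernoulli (Function.update u e 0)).real (openConn v b))) ∧
          ((∃ d ∈ A, (∀ a ∈ A, (prodBernoulli (Function.update u e 1)).real (openConn d b) ≤ (prodBernoulli (Function.update u e 1)).real (openConn a b)) ∧
              (prodBernoulli (fun e' : Sym2 (Fin n) => if (∀ y ∈ e', y ∈ S) ∧ ¬ e'.IsDiag then 1 else Function.update u e 1 e')).real ((⋃ v ∈ S, ⋃ a ∈ A, openConn v a) ∩ openConn a₀ b)
                ≤ (prodBernoulli (fun e' : Sym2 (Fin n) => if (∀ y ∈ e', y ∈ S) ∧ ¬ e'.IsDiag then 1 else Function.update u e 1 e')).real ((⋃ v ∈ S, ⋃ a ∈ A, openConn v a) ∩ openConn d b))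
          ∨ (∃ v ∈ S, (prodBernoulli (Function.update u e 1)).real (openConn a₀ b) ≤ (prodBernoulli (Function.update u e 1)).real (openConn v b)))) →
      (prodBernoulli (fun e' : Sym2 (Fin n) => if (∀ y ∈ e', y ∈ S) ∧ ¬ e'.IsDiag then 1 else u e')).real ((⋃ v ∈ S, ⋃ a ∈ A, openConn v a) ∩ openConn a₀ b)
        ≤ (prodBernoulli (fun e' : Sym2 (Fin n) => if (∀ y ∈ e', y ∈ S) ∧ ¬ e'.IsDiag then 1 else u e')).real (⋃ v ∈ S, openConn v b)) :
    ∀ (n : ℕ) (w : Sym2 (Fin n) → unitInterval) (A : Finset (Fin n)) (o b : Fin n) (t : ℝ), 0 ≤ t →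
      (∀ a ∈ A, 1 - t ≤ (prodBernoulli w).real (openConn a b)) →
      (prodBernoulli w).real (⋃ a ∈ A, openConn o a) - t ≤ (prodBernoulli w).real (openConn o b) :=
  additiveGluing_of_dcone (cone_dkernel_of_cert3 hG)

end DKernelReduction3

end

end Summit.CriticalPhenomena.PercolationContinuityZ3.Theorems
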